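import Literature.NumberTheory.NumberFields.CubicField14483ClassGroup
import Literature.NumberTheory.EllipticCurves.KummerSelmerGroupFinite
import Literature.NumberTheory.NumberFields.SelmerGroupOddClass
import HarnessLib

/-!
# The cubic field of discriminant `-14483`, VIII: `K(∅, 2) = ⟨-1, ε, π₀⟩` and the reduction of `K(S, 2)` to it

Eighth file on the `2`-division field `K = ℚ(γ)` of `E_{28/9}` (`Cl(K) = ⟨[𝔭₂]⟩ ≅ ℤ/8`, part VII). The Selmer groups of a
`2`-isogeny descent over `K` live in `K(S, 2) = {x ∈ Kˣ/Kˣ² : ord_v(x) even ∀ v ∉ S}` (Silverman, *AEC*, X.1.1(c),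
VIII.1.6; tree `TwoIsogenySelmerGroupShaNF.mk_mem_selmerGroup_of_twoIsogenyTorsorHom_mem_sha'`); this file makes these
groups explicit for `K`:

* §1 `two_dvd_log_p2_of_forall_ne` — **parity at `𝔭₂` is automatic**: if `ord_v(z)` is even for every `v ≠ 𝔭₂` then
  `ord_{𝔭₂}(z)` is even too (`[𝔭₂]` generates `Cl(K) ≅ ℤ/8`, so it is not a square class).
* §2 `exists_rep_of_forall_two_dvd_log` — **`K(∅, 2) = ⟨-1, ε, π₀⟩`**: an element all of whose valuations are even is
  `± ε^{0,1} π₀^{0,1}` times a square (`(z) = J²`; `[J]² = 1` gives `[J] ∈ {1, [𝔭₂]⁴}` by part VII; `J = (w)` gives a unit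
  times `w²`, `J 𝔭₂⁴ = (w)` gives `π₀ ×` unit `×` square since `𝔭₂⁸ = (π₀)`, `π₀ = 6 + γ - δ`; units are
  `± ε^{0,1} η²` by part IV).
* §3 `exists_rep_of_two_dvd_log_outside` — **`K(S, 2)` for `S = {𝔭₂} ∪ {P₁, …, P_m}`** with witnesses
  `(g_j) = P_j 𝔭₂^{k_j}` (parts V–VI): an element with even valuations outside `S` is `± ε^{0,1} π₀^{0,1} ∏_{j ∈ T} g_j`
  times a square for a sublist `T` (peel off `g_j` at the `P_j` with odd order, then §1–§2).

Everything is proved; theorems only.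

## References
* [SilvermanAEC2009] J. H. Silverman, *The Arithmetic of Elliptic Curves*, 2nd ed. (2009), Prop. VIII.1.6 (proof) and
  Thm. X.1.1(c) (`K(S, 2)`).
* [Marcus2018] D. A. Marcus, *Number Fields*, 2nd ed. (2018), Ch. 5, Thm. 35–38.
-/

noncomputable section

open Polynomial Module NumberField Ideal IsDedekindDomain
open scoped NumberField nonZeroDivisors

namespace Literature.NumberTheory.NumberFields

namespace CubicField14483

open MonicCubic

variable {K : Type*} [Field K] [NumberField K] {γ : K}

/-! ### §1 Parity at `𝔭₂` is automatic -/

omit [NumberField K] in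
/-- The finite place `𝔭₂ = ker ψ₁`. [cite: Marcus2018, Ch. 3, Thm. 27] -/
theorem isPrime_ker_psi_two (ψ₁ : 𝓞 K →+* ZMod 2) : (RingHom.ker ψ₁).IsPrime :=
  haveI : Fact (Nat.Prime 2) := ⟨Nat.prime_two⟩
  (ker_zmod_isMaximal ψ₁).isPrime

/-- **`[𝔭₂]` is not a square class, in graded form**: `[𝔭₂]ⁿ = c²` forces `n` even (`Cl(K) = ⟨[𝔭₂]⟩` of order `8`).
[cite: Marcus2018, Ch. 5, Thm. 35] -/
theorem even_of_mk0_p2_zpow_eq_sq (hγ : γ ^ 3 - γ ^ 2 + 27 * γ + 36 = 0) (h3 : finrank ℚ K = 3)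
    (ψ₁ : 𝓞 K →+* ZMod 2) {n : ℤ} {c : ClassGroup (𝓞 K)}
    (h : ClassGroup.mk0 ⟨RingHom.ker ψ₁, ker_psi_two_mem_nonZeroDivisors ψ₁⟩ ^ n = c ^ 2) : Even n := by
  set g := ClassGroup.mk0 ⟨RingHom.ker ψ₁, ker_psi_two_mem_nonZeroDivisors ψ₁⟩ with hg
  obtain ⟨k, rfl⟩ := Subgroup.mem_zpowers_iff.mp
    (show c ∈ Subgroup.zpowers g by rw [hg, zpowers_p2_eq_top hγ h3 ψ₁]; exact Subgroup.mem_top c)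
  have h1 : g ^ (n - k * 2) = 1 := by rw [zpow_sub, h, zpow_mul, zpow_two, ← pow_two, mul_inv_cancel]
  have hdvd := orderOf_dvd_iff_zpow_eq_one.mpr h1
  rw [hg, orderOf_mk0_p2 hγ h3 ψ₁] at hdvd
  push_cast at hdvd
  exact ⟨k + 4 * ((n - k * 2) / 8), by omega⟩

/-- An ideal all of whose prime-factor multiplicities are even is a square. [cite: SilvermanAEC2009, Prop. VIII.1.6 (proof)] -/
theorem exists_sq_eq_of_dvd_count {I : Ideal (𝓞 K)} (hI : I ≠ ⊥)
    (h : ∀ v : HeightOneSpectrum (𝓞 K), 2 ∣ (Associates.mk v.asIdeal).count (Associates.mk I).factors) :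
    ∃ J : Ideal (𝓞 K), J ^ 2 = I := by
  have h0 : Associates.mk I ≠ 0 := by rwa [Associates.mk_ne_zero, Ne, Ideal.zero_eq_bot]
  obtain ⟨b, hb⟩ := Associates.is_pow_of_dvd_count h0 fun p hp => by
    obtain ⟨P, rfl⟩ := Associates.mk_surjective p
    rw [Associates.irreducible_mk] at hp
    exact h ⟨P, Ideal.isPrime_of_prime (irreducible_iff_prime.mp hp), hp.ne_zero⟩
  obtain ⟨J, rfl⟩ := Associates.mk_surjective b
  refine ⟨J, ?_⟩
  rw [← Associates.mk_pow, Associates.mk_eq_mk_iff_associated] at hb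
  exact (associated_iff_eq.mp hb).symm

/-- **`ord_{𝔭₂}` is even as soon as all other orders are**: for `z ∈ Kˣ` with `ord_v(z)` even for every finite place
`v ≠ 𝔭₂`, also `ord_{𝔭₂}(z)` is even — otherwise `(r) 𝔭₂^{a} = J²` (`r` an integral representative, `a = ord_{𝔭₂} r`
odd) would make `[𝔭₂]^a` a square in `Cl(K) = ⟨[𝔭₂]⟩ ≅ ℤ/8`. [cite: SilvermanAEC2009, Prop. VIII.1.6 (proof)] -/
theorem two_dvd_log_p2_of_forall_ne (hγ : γ ^ 3 - γ ^ 2 + 27 * γ + 36 = 0) (h3 : finrank ℚ K = 3)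
    (ψ₁ : 𝓞 K →+* ZMod 2) {z : K} (hz : z ≠ 0)
    (h : ∀ v : HeightOneSpectrum (𝓞 K), v.asIdeal ≠ RingHom.ker ψ₁ → (2 : ℤ) ∣ WithZero.log (v.valuation K z)) :
    ∀ v : HeightOneSpectrum (𝓞 K), (2 : ℤ) ∣ WithZero.log (v.valuation K z) := by
  classical
  haveI : Fact (Nat.Prime 2) := ⟨Nat.prime_two⟩
  set P : HeightOneSpectrum (𝓞 K) := ⟨RingHom.ker ψ₁, isPrime_ker_psi_two ψ₁, ker_zmod_ne_bot ψ₁⟩ with hPdef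
  -- an integral representative `r` of the class of `z` modulo squares
  set zU : Kˣ := Units.mk0 z hz with hzU
  obtain ⟨r, x, hr, hx, hclass⟩ := IsDedekindDomain.exists_mk_eq_of_pos (R := 𝓞 K) (K := K) two_pos
    (QuotientGroup.mk zU : Kˣ ⧸ (powMonoidHom 2 : Kˣ →* Kˣ).range)
  obtain ⟨t, ht⟩ := MonoidHom.mem_range.mp (QuotientGroup.eq.mp hclass)
  rw [powMonoidHom_apply] at ht
  have hzx : zU = x * t ^ 2 := by rw [ht, mul_inv_cancel_left]
  -- `count_v (r) ≡ -ord_v z (mod 2)`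
  have hrel : ∀ v : HeightOneSpectrum (𝓞 K),
      ((Associates.mk v.asIdeal).count (Associates.mk (Ideal.span {r})).factors : ℤ) =
        -WithZero.log (v.valuation K z) + 2 * Multiplicative.toAdd (v.valuationOfNeZero (K := K) t) := by
    intro v
    have h1 := v.toAdd_valuationOfNeZero_of_eq_algebraMap (K := K) hr hx
    have h2 := v.toAdd_valuationOfNeZero_eq_log (K := K) zU
    have h3 : v.valuationOfNeZero (K := K) zU =
        v.valuationOfNeZero (K := K) x * (v.valuationOfNeZero (K := K) t) ^ 2 := by
      rw [hzx, map_mul, map_pow]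
    have h4 := congrArg Multiplicative.toAdd h3
    rw [toAdd_mul, toAdd_pow, h1, h2] at h4
    have hzc : ((zU : Kˣ) : K) = z := by rw [hzU]; rfl
    rw [hzc, nsmul_eq_mul] at h4
    push_cast at h4
    linarith
  have hcount : ∀ v : HeightOneSpectrum (𝓞 K), v ≠ P →
      2 ∣ (Associates.mk v.asIdeal).count (Associates.mk (Ideal.span {r})).factors := by
    intro v hv
    have hv' : v.asIdeal ≠ RingHom.ker ψ₁ := fun e => hv (HeightOneSpectrum.ext (by rw [e]))
    obtain ⟨m, hm⟩ := h v hv'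
    have : (2 : ℤ) ∣ ((Associates.mk v.asIdeal).count (Associates.mk (Ideal.span {r})).factors : ℤ) :=
      ⟨-m + Multiplicative.toAdd (v.valuationOfNeZero (K := K) t), by rw [hrel v, hm]; ring⟩
    exact_mod_cast this
  -- suppose `a = count_P (r)` is odd: then `(r) P^a` has even multiplicities, so is a square `J²`
  set a := (Associates.mk P.asIdeal).count (Associates.mk (Ideal.span {r})).factors with ha
  by_contra hodd
  push Not at hodd
  obtain ⟨v₀, hv₀⟩ := hodd
  have hv₀P : v₀ = P := by
    by_contra hne
    obtain ⟨m, hm⟩ := hcount v₀ hne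
    exact hv₀ ⟨-(m : ℤ) + Multiplicative.toAdd (v₀.valuationOfNeZero (K := K) t), by
      have := hrel v₀; rw [hm] at this; push_cast at this; linarith⟩
  subst hv₀P
  have haodd : ¬ 2 ∣ a := by
    intro ⟨m, hm⟩
    exact hv₀ ⟨-(m : ℤ) + Multiplicative.toAdd (P.valuationOfNeZero (K := K) t), by
      have := hrel P; rw [← ha, hm] at this; push_cast at this; linarith⟩
  have hr0 : Ideal.span {r} ≠ ⊥ := by rwa [Ne, Ideal.span_singleton_eq_bot]
  have hI0 : Ideal.span {r} * P.asIdeal ^ a ≠ ⊥ := mul_ne_zero hr0 (pow_ne_zero a P.ne_bot)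
  have hsq : ∀ v : HeightOneSpectrum (𝓞 K),
      2 ∣ (Associates.mk v.asIdeal).count (Associates.mk (Ideal.span {r} * P.asIdeal ^ a)).factors := by
    intro v
    have hvirr : Irreducible (Associates.mk v.asIdeal) := (Associates.irreducible_mk).mpr v.irreducible
    rw [← Associates.mk_mul_mk, Associates.count_mul (by rwa [Associates.mk_ne_zero, Ne, Ideal.zero_eq_bot])
      (by rw [Associates.mk_ne_zero, Ideal.zero_eq_bot]; exact pow_ne_zero a P.ne_bot) hvirr,
      Associates.mk_pow, Associates.count_pow (by rw [Associates.mk_ne_zero, Ideal.zero_eq_bot]; exact P.ne_bot) hvirr]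
    by_cases hvP : v = P
    · subst hvP
      rw [Associates.count_self hvirr, mul_one, ← ha]; exact ⟨a, by ring⟩
    · have hPirr : Irreducible (Associates.mk P.asIdeal) := (Associates.irreducible_mk).mpr P.irreducible
      rw [Associates.count_eq_zero_of_ne hvirr hPirr (fun e => hvP (HeightOneSpectrum.ext
        (by rwa [Associates.mk_eq_mk_iff_associated, associated_iff_eq] at e))), mul_zero, add_zero]
      exact hcount v hvP
  obtain ⟨J, hJ⟩ := exists_sq_eq_of_dvd_count hI0 hsq
  -- in the class group: `[𝔭₂]^a = [J]²`, contradiction with `a` odd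
  have hJ0 : J ≠ ⊥ := by
    intro h0; rw [h0, ← Ideal.zero_eq_bot, zero_pow two_ne_zero] at hJ; exact hI0 hJ.symm
  have hPnz : P.asIdeal ∈ (Ideal (𝓞 K))⁰ := ker_psi_two_mem_nonZeroDivisors ψ₁
  have hcl : ClassGroup.mk0 ⟨RingHom.ker ψ₁, ker_psi_two_mem_nonZeroDivisors ψ₁⟩ ^ (a : ℤ) =
      ClassGroup.mk0 ⟨J, mem_nonZeroDivisors_of_ne_zero hJ0⟩ ^ 2 := by
    rw [zpow_natCast, ← map_pow, ← map_pow]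
    have e1 : (⟨J, mem_nonZeroDivisors_of_ne_zero hJ0⟩ ^ 2 : (Ideal (𝓞 K))⁰) =
        ⟨Ideal.span {r}, mem_nonZeroDivisors_of_ne_zero hr0⟩ *
          ⟨RingHom.ker ψ₁, ker_psi_two_mem_nonZeroDivisors ψ₁⟩ ^ a := by
      apply Subtype.ext
      simp only [SubmonoidClass.coe_pow, Submonoid.coe_mul]
      rw [hJ]
    rw [e1, map_mul, (ClassGroup.mk0_eq_one_iff _).mpr ⟨⟨r, rfl⟩⟩, one_mul]
  have heven := even_of_mk0_p2_zpow_eq_sq hγ h3 ψ₁ hcl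
  exact haodd (by exact_mod_cast heven.two_dvd)

/-! ### §2 `K(∅, 2) = ⟨-1, ε, π₀⟩` -/

/-- `π₀ = 6 + γ - δ ≠ 0` in `K` (`N(π₀) = -256`). [cite: Marcus2018, Ch. 5, Thm. 35] -/
theorem algebraMap_pi0_ne_zero (hγ : γ ^ 3 - γ ^ 2 + 27 * γ + 36 = 0) (h3 : finrank ℚ K = 3) :
    algebraMap (𝓞 K) K (((6 : ℤ) : 𝓞 K) + (1 : ℤ) * thetaInt (aeval_eq hγ) + (-1 : ℤ) * thetaInt (delta_root hγ)) ≠ 0 := by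
  intro h0
  rw [map_eq_zero_iff _ (IsFractionRing.injective (𝓞 K) K)] at h0
  have h := congrArg (Algebra.norm ℤ) h0
  rw [norm_lin3 hγ h3, Algebra.norm_zero] at h
  norm_num at h

/-- **`K(∅, 2) = ⟨-1, ε, π₀⟩ · Kˣ²`**: an element of `Kˣ` all of whose valuations are even is
`(-1)^s ε^i π₀^c w²` with `s, i, c ∈ {0, 1}` (`ε = -15 - γ + 2δ`, `π₀ = 6 + γ - δ`): `(z) ∼ (r) = J²`, `[J]² = 1`, so
`[J] = 1` (then `r =` unit `· w²`) or `[J] = [𝔭₂]⁴` (then `J 𝔭₂⁴ = (w)`, `(r)(π₀) = (w²)`), and units are `± ε^{0,1} η²`.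
[cite: SilvermanAEC2009, Prop. VIII.1.6 (proof)] -/
theorem exists_rep_of_forall_two_dvd_log (hγ : γ ^ 3 - γ ^ 2 + 27 * γ + 36 = 0) (h3 : finrank ℚ K = 3) {z : K}
    (hz : z ≠ 0) (h : ∀ v : HeightOneSpectrum (𝓞 K), (2 : ℤ) ∣ WithZero.log (v.valuation K z)) :
    ∃ (s i c : Fin 2) (w : K), z = (-1) ^ (s : ℕ) *
      algebraMap (𝓞 K) K (-15 - thetaInt (aeval_eq hγ) + 2 * thetaInt (delta_root hγ)) ^ (i : ℕ) *
      algebraMap (𝓞 K) K (((6 : ℤ) : 𝓞 K) + (1 : ℤ) * thetaInt (aeval_eq hγ) + (-1 : ℤ) * thetaInt (delta_root hγ))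
        ^ (c : ℕ) * w ^ 2 := by
  classical
  obtain ⟨ψ₁, -⟩ := exists_psi_two hγ h3
  haveI : Fact (Nat.Prime 2) := ⟨Nat.prime_two⟩
  set εe : 𝓞 K := -15 - thetaInt (aeval_eq hγ) + 2 * thetaInt (delta_root hγ) with hεe
  set π₀ : 𝓞 K := ((6 : ℤ) : 𝓞 K) + (1 : ℤ) * thetaInt (aeval_eq hγ) + (-1 : ℤ) * thetaInt (delta_root hγ) with hπ₀
  set εU : (𝓞 K)ˣ := Units.mkOfMulEqOne (-15 - thetaInt (aeval_eq hγ) + 2 * thetaInt (delta_root hγ))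
    (183 - 19 * thetaInt (aeval_eq hγ) + 47 * thetaInt (delta_root hγ)) (eps_mul_inv hγ) with hεU
  have hεUval : (εU : 𝓞 K) = εe := by rw [hεU, Units.val_mkOfMulEqOne]
  -- an integral representative `r` of the class of `z`, `z = r t²`
  set zU : Kˣ := Units.mk0 z hz with hzU
  obtain ⟨r, x, hr, hx, hclass⟩ := IsDedekindDomain.exists_mk_eq_of_pos (R := 𝓞 K) (K := K) two_pos
    (QuotientGroup.mk zU : Kˣ ⧸ (powMonoidHom 2 : Kˣ →* Kˣ).range)
  obtain ⟨t, ht⟩ := MonoidHom.mem_range.mp (QuotientGroup.eq.mp hclass)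
  rw [powMonoidHom_apply] at ht
  have hzx : zU = x * t ^ 2 := by rw [ht, mul_inv_cancel_left]
  have hzL : z = algebraMap (𝓞 K) K r * (t : K) ^ 2 := by
    have := congrArg (fun y : Kˣ => (y : K)) hzx
    simpa [hzU, hx] using this
  -- `(r) = J²`
  have hcount : ∀ v : HeightOneSpectrum (𝓞 K),
      2 ∣ (Associates.mk v.asIdeal).count (Associates.mk (Ideal.span {r})).factors := by
    intro v
    have h1 := v.toAdd_valuationOfNeZero_of_eq_algebraMap (K := K) hr hx
    have h2 := v.toAdd_valuationOfNeZero_eq_log (K := K) zU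
    have h3' : v.valuationOfNeZero (K := K) zU =
        v.valuationOfNeZero (K := K) x * (v.valuationOfNeZero (K := K) t) ^ 2 := by
      rw [hzx, map_mul, map_pow]
    have h4 := congrArg Multiplicative.toAdd h3'
    rw [toAdd_mul, toAdd_pow, h1, h2] at h4
    have hzc : ((zU : Kˣ) : K) = z := by rw [hzU]; rfl
    rw [hzc, nsmul_eq_mul] at h4
    push_cast at h4
    obtain ⟨m, hm⟩ := h v
    have : (2 : ℤ) ∣ ((Associates.mk v.asIdeal).count (Associates.mk (Ideal.span {r})).factors : ℤ) :=
      ⟨-m + Multiplicative.toAdd (v.valuationOfNeZero (K := K) t), by linarith⟩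
    exact_mod_cast this
  obtain ⟨J, hJ⟩ := IsDedekindDomain.exists_pow_eq_span_singleton_of_dvd_count hr hcount
  have hr0 : Ideal.span {r} ≠ ⊥ := by rwa [Ne, Ideal.span_singleton_eq_bot]
  have hJ0 : J ≠ ⊥ := by
    intro h0; rw [h0, ← Ideal.zero_eq_bot, zero_pow two_ne_zero] at hJ; exact hr0 hJ.symm
  have hcl : (ClassGroup.mk0 ⟨J, mem_nonZeroDivisors_of_ne_zero hJ0⟩) ^ 2 = 1 := by
    rw [← map_pow, ClassGroup.mk0_eq_one_iff]
    change Submodule.IsPrincipal (J ^ 2)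
    rw [hJ]
    exact ⟨⟨r, rfl⟩⟩
  rcases (sq_eq_one_iff hγ h3 ψ₁ _).mp hcl with h1 | h4
  · -- `J = (w)` principal: `r = w² u`, `u = (-1)^s ε^i η²`
    have hprinc : Submodule.IsPrincipal J := (ClassGroup.mk0_eq_one_iff _).mp h1
    obtain ⟨w, hw⟩ : ∃ w : 𝓞 K, J = Ideal.span {w} := ⟨_, hprinc.span_singleton_generator.symm⟩
    rw [hw, Ideal.span_singleton_pow, Ideal.span_singleton_eq_span_singleton] at hJ
    obtain ⟨u, hu⟩ := hJ
    obtain ⟨s, i, η, hη⟩ := unit_eq_rep_mul_sq hγ h3 u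
    refine ⟨s, i, 0, algebraMap (𝓞 K) K w * algebraMap (𝓞 K) K η * (t : K), ?_⟩
    have hrK : algebraMap (𝓞 K) K r = algebraMap (𝓞 K) K w ^ 2 *
        ((-1) ^ (s : ℕ) * algebraMap (𝓞 K) K εe ^ (i : ℕ) * algebraMap (𝓞 K) K η ^ 2) := by
      rw [← hu, hη, hεe]
      simp only [map_mul, map_pow, Units.val_mul, Units.val_pow_eq_pow_val, Units.val_neg, Units.val_one, map_neg,
        map_one, Units.val_mkOfMulEqOne]
    simp only [hzL, hrK, Fin.val_zero, pow_zero, mul_one]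
    ring
  · -- `[J] = [𝔭₂]⁴`: `J 𝔭₂⁴ = (w)`, `(r)(π₀) = (w²)`
    have h8 : ClassGroup.mk0 ⟨J * RingHom.ker ψ₁ ^ 4, mem_nonZeroDivisors_of_ne_zero
        (mul_ne_zero hJ0 (pow_ne_zero 4 (ker_zmod_ne_bot ψ₁)))⟩ = 1 := by
      have e : (⟨J * RingHom.ker ψ₁ ^ 4, mem_nonZeroDivisors_of_ne_zero
          (mul_ne_zero hJ0 (pow_ne_zero 4 (ker_zmod_ne_bot ψ₁)))⟩ : (Ideal (𝓞 K))⁰) =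
          ⟨J, mem_nonZeroDivisors_of_ne_zero hJ0⟩ * ⟨RingHom.ker ψ₁, ker_psi_two_mem_nonZeroDivisors ψ₁⟩ ^ 4 := by
        apply Subtype.ext
        simp only [SubmonoidClass.coe_pow, Submonoid.coe_mul]
      rw [e, map_mul, map_pow, h4, ← pow_add]
      exact mk0_p2_pow_eight hγ h3 ψ₁
    have hprinc : Submodule.IsPrincipal (J * RingHom.ker ψ₁ ^ 4) := (ClassGroup.mk0_eq_one_iff _).mp h8
    obtain ⟨w, hw⟩ : ∃ w : 𝓞 K, J * RingHom.ker ψ₁ ^ 4 = Ideal.span {w} :=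
      ⟨_, hprinc.span_singleton_generator.symm⟩
    have hprod : Ideal.span {r * π₀} = Ideal.span {w ^ 2} := by
      rw [← Ideal.span_singleton_mul_span_singleton, ← hJ, hπ₀, span_pi0_eq_p2_pow_eight hγ h3 ψ₁ (psi_two_gamma hγ ψ₁),
        ← Ideal.span_singleton_pow, ← hw, mul_pow, ← pow_mul]
    obtain ⟨u, hu⟩ := Ideal.span_singleton_eq_span_singleton.mp hprod
    obtain ⟨s, i, η, hη⟩ := unit_eq_rep_mul_sq hγ h3 u⁻¹
    have hπK := algebraMap_pi0_ne_zero hγ h3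
    rw [← hπ₀] at hπK
    have hrK : algebraMap (𝓞 K) K r * algebraMap (𝓞 K) K π₀ = algebraMap (𝓞 K) K w ^ 2 *
        ((-1) ^ (s : ℕ) * algebraMap (𝓞 K) K εe ^ (i : ℕ) * algebraMap (𝓞 K) K η ^ 2) := by
      have e : r * π₀ = w ^ 2 * ((u⁻¹ : (𝓞 K)ˣ) : 𝓞 K) := by rw [← hu, mul_assoc, Units.mul_inv, mul_one]
      rw [← map_mul, e, hη, hεe]
      simp only [map_mul, map_pow, Units.val_mul, Units.val_pow_eq_pow_val, Units.val_neg, Units.val_one, map_neg,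
        map_one, Units.val_mkOfMulEqOne]
    have hr' : algebraMap (𝓞 K) K r = algebraMap (𝓞 K) K w ^ 2 *
        ((-1) ^ (s : ℕ) * algebraMap (𝓞 K) K εe ^ (i : ℕ) * algebraMap (𝓞 K) K η ^ 2) / algebraMap (𝓞 K) K π₀ := by
      rw [eq_div_iff hπK]; exact hrK
    refine ⟨s, i, 1, algebraMap (𝓞 K) K w * algebraMap (𝓞 K) K η * (t : K) / algebraMap (𝓞 K) K π₀, ?_⟩
    simp only [hzL, hr', Fin.val_one, pow_one]
    field_simp


/-! ### §3 `K(S, 2)` by peeling the witnesses -/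

open scoped Classical in
/-- **Valuations of a witness `(g) = P · Qᵏ`** away from `Q`: `log v(g) = -1` for `v = P` and `0` for `v ≠ P, Q`
(`P ≠ Q` non-zero primes). [cite: Marcus2018, Ch. 3, Thm. 22] -/
theorem log_valuation_of_span_eq_mul_pow {P v : HeightOneSpectrum (𝓞 K)} {Q : Ideal (𝓞 K)} [hQ : Q.IsPrime]
    (hQ0 : Q ≠ ⊥) {k : ℕ} {g : 𝓞 K} (hg : Ideal.span {g} = P.asIdeal * Q ^ k) (hPQ : P.asIdeal ≠ Q)
    (hvQ : v.asIdeal ≠ Q) : WithZero.log (v.valuation K (g : K)) = if v = P then -1 else 0 := by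
  have hQmax : Q.IsMaximal := hQ.isMaximal hQ0
  have hg0 : g ≠ 0 := by
    intro h0
    rw [h0, Ideal.span_singleton_eq_bot.mpr rfl, eq_comm, mul_eq_bot] at hg
    rcases hg with h | h
    · exact P.ne_bot h
    · exact hQ0 (pow_eq_zero_iff'.mp (h.trans Ideal.zero_eq_bot.symm)).1
  split_ifs with hv
  · subst hv
    have hmem : g ∈ v.asIdeal ^ 1 := by
      rw [pow_one, ← Ideal.dvd_span_singleton, hg]; exact dvd_mul_right _ _
    have hnot : g ∉ v.asIdeal ^ 2 := by
      intro h2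
      rw [← Ideal.dvd_span_singleton, hg, pow_two, mul_dvd_mul_iff_left v.ne_bot] at h2
      have h3 : v.asIdeal ∣ Q := v.prime.dvd_of_dvd_pow h2
      exact hPQ (hQmax.eq_of_le v.isPrime.ne_top (Ideal.le_of_dvd h3)).symm
    rw [mem_pow_iff_log_valuation_le v hg0] at hmem hnot
    push_cast at hmem hnot
    omega
  · have hnot : g ∉ v.asIdeal := by
      intro hmem
      have h1 : v.asIdeal ∣ P.asIdeal * Q ^ k := by rw [← hg, Ideal.dvd_span_singleton]; exact hmem
      rcases v.prime.dvd_or_dvd h1 with h2 | h2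
      · exact hv (HeightOneSpectrum.ext ((P.isPrime.isMaximal P.ne_bot).eq_of_le v.isPrime.ne_top
          (Ideal.le_of_dvd h2)).symm)
      · have h3 : v.asIdeal ∣ Q := v.prime.dvd_of_dvd_pow h2
        exact hvQ (hQmax.eq_of_le v.isPrime.ne_top (Ideal.le_of_dvd h3)).symm
    exact log_valuation_eq_zero_of_not_mem v hnot

open scoped Classical in
/-- **`K(S, 2)` from `K(∅, 2)` by peeling the witnesses.** Let `L` be a list of pairs `(P_j, g_j)`: finite places
`P_j ≠ 𝔭₂` with `(g_j) = P_j · 𝔭₂^{k_j}` (parts V–VI). If `z ∈ Kˣ` has `ord_v(z)` even for every finite place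
`v ∉ {𝔭₂} ∪ {P_j}`, then `z = (-1)^s ε^i π₀^c · ∏_{g ∈ l} g · w²` with `s, i, c ∈ {0, 1}` and `l` a sublist of `(g_j)`:
divide by `g_j` at each `P_j` of odd order, then use §1 (parity at `𝔭₂` is automatic) and §2.
[cite: SilvermanAEC2009, Prop. VIII.1.6 (proof)] -/
theorem exists_rep_of_two_dvd_log_outside (hγ : γ ^ 3 - γ ^ 2 + 27 * γ + 36 = 0) (h3 : finrank ℚ K = 3)
    (ψ₁ : 𝓞 K →+* ZMod 2) (L : List (HeightOneSpectrum (𝓞 K) × 𝓞 K))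
    (hL : ∀ p ∈ L, p.1.asIdeal ≠ RingHom.ker ψ₁ ∧ ∃ k : ℕ, Ideal.span {p.2} = p.1.asIdeal * RingHom.ker ψ₁ ^ k)
    {z : K} (hz : z ≠ 0)
    (h : ∀ v : HeightOneSpectrum (𝓞 K), v.asIdeal ≠ RingHom.ker ψ₁ → (∀ p ∈ L, v ≠ p.1) →
      (2 : ℤ) ∣ WithZero.log (v.valuation K z)) :
    ∃ (s i c : Fin 2) (l : List (𝓞 K)) (w : K), l.Sublist (L.map Prod.snd) ∧
      z = (-1) ^ (s : ℕ) * algebraMap (𝓞 K) K (-15 - thetaInt (aeval_eq hγ) + 2 * thetaInt (delta_root hγ)) ^ (i : ℕ) *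
        algebraMap (𝓞 K) K (((6 : ℤ) : 𝓞 K) + (1 : ℤ) * thetaInt (aeval_eq hγ) + (-1 : ℤ) * thetaInt (delta_root hγ))
          ^ (c : ℕ) * algebraMap (𝓞 K) K l.prod * w ^ 2 := by
  haveI : Fact (Nat.Prime 2) := ⟨Nat.prime_two⟩
  haveI : (RingHom.ker ψ₁).IsPrime := isPrime_ker_psi_two ψ₁
  induction L generalizing z with
  | nil =>
    have hall := two_dvd_log_p2_of_forall_ne hγ h3 ψ₁ hz fun v hv => h v hv (by simp)
    obtain ⟨s, i, c, w, hw⟩ := exists_rep_of_forall_two_dvd_log hγ h3 hz hall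
    exact ⟨s, i, c, [], w, List.Sublist.slnil, by rw [List.prod_nil, map_one, mul_one]; exact hw⟩
  | cons p L ih =>
    obtain ⟨hP2, k, hg⟩ := hL p (by simp)
    have hL' : ∀ q ∈ L, q.1.asIdeal ≠ RingHom.ker ψ₁ ∧ ∃ k : ℕ, Ideal.span {q.2} = q.1.asIdeal * RingHom.ker ψ₁ ^ k :=
      fun q hq => hL q (List.mem_cons_of_mem _ hq)
    have hg0 : algebraMap (𝓞 K) K p.2 ≠ 0 := by
      intro h0
      rw [map_eq_zero_iff _ (IsFractionRing.injective (𝓞 K) K)] at h0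
      rw [h0, Ideal.span_singleton_eq_bot.mpr rfl, eq_comm, mul_eq_bot] at hg
      rcases hg with h1 | h1
      · exact p.1.ne_bot h1
      · exact ker_zmod_ne_bot ψ₁ (pow_eq_zero_iff'.mp (h1.trans Ideal.zero_eq_bot.symm)).1
    by_cases hpar : (2 : ℤ) ∣ WithZero.log (p.1.valuation K z)
    · -- even at `P`: nothing to peel
      obtain ⟨s, i, c, l, w, hl, hw⟩ := ih hL' hz fun v hv hvL => by
        by_cases hvp : v = p.1
        · rw [hvp]; exact hpar
        · exact h v hv fun q hq => by
            rcases List.mem_cons.mp hq with rfl | hq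
            · exact hvp
            · exact hvL q hq
      exact ⟨s, i, c, l, w, hl.trans (List.sublist_cons_self _ _), hw⟩
    · -- odd at `P`: divide by `g`
      have hz' : z / algebraMap (𝓞 K) K p.2 ≠ 0 := div_ne_zero hz hg0
      have hlog : ∀ v : HeightOneSpectrum (𝓞 K), v.asIdeal ≠ RingHom.ker ψ₁ →
          WithZero.log (v.valuation K (z / algebraMap (𝓞 K) K p.2)) =
            WithZero.log (v.valuation K z) - (if v = p.1 then -1 else 0) := by
        intro v hv
        rw [map_div₀, div_eq_mul_inv, WithZero.log_mul ((Valuation.ne_zero_iff _).mpr hz)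
          (inv_ne_zero ((Valuation.ne_zero_iff _).mpr hg0)), WithZero.log_inv,
          show algebraMap (𝓞 K) K p.2 = (p.2 : K) from rfl, log_valuation_of_span_eq_mul_pow (K := K) (ker_zmod_ne_bot ψ₁) hg hP2 hv]
        ring
      obtain ⟨s, i, c, l, w, hl, hw⟩ := ih hL' hz' fun v hv hvL => by
        rw [hlog v hv]
        by_cases hvp : v = p.1
        · rw [if_pos hvp]
          subst hvp
          have := Int.emod_two_eq_zero_or_one (WithZero.log (p.1.valuation K z))
          omega
        · rw [if_neg hvp, sub_zero]
          exact h v hv fun q hq => by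
            rcases List.mem_cons.mp hq with rfl | hq
            · exact hvp
            · exact hvL q hq
      refine ⟨s, i, c, p.2 :: l, w, hl.cons_cons p.2, ?_⟩
      rw [List.prod_cons, map_mul]
      rw [div_eq_iff hg0] at hw
      linear_combination hw


end CubicField14483

end Literature.NumberTheory.NumberFields

end
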